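import Literature.NumberTheory.GaloisRepresentations.TateModuleKummerCompletion
import Literature.AnabelianGeometry.AbsoluteAnabelian.GaloisCyclotomeTateModule
import Literature.NumberTheory.GaloisRepresentations.TateDualityCounting
import Literature.AnabelianGeometry.AbsoluteAnabelian.LocalReciprocityCompletionProofs
import HarnessLib

/-!
# [AbsTopIII] Cor. 1.10 (i)(b): `H¹(G_k, μ_Ẑ(G_k)) ≅ G_k^ab` — DISCHARGE of the named fact `AbsTopIII.Cor_1_10_i_b`

Mochizuki, *Topics in Absolute Anabelian Geometry III*, Cor. 1.10 (i)(b) p. 42 (kurims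
`paper:url-5493eb38cbb7`): "by applying the isomorphism of (a) [and the cup-product in group
cohomology], one constructs the surjection `H¹(G_k, μ_Ẑ(G_k)) ⥲ G_k^ab ↠ G^unr ⥲ Ẑ`".  The tree typed the
first isomorphism as the named fact `AbsTopIII.Cor_1_10_i_b` (abc-iut-L4-t1, `CyclotomicSynchronization.lean`):
for `k` an MLF, `Nonempty (galCyclotomeH1 G_k ≃+ Additive (TopologicalAbelianization G_k))`, with
`galCyclotomeH1 G = H¹_cont(G, μ_Ẑ(G))` Mathlib's REAL continuous cohomology of the group-theoretic
cyclotome.  This file PROVES it (proof-only; no definition, no named fact), composing kernel theorems: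

1. `galCyclotomeTopRep G_k ≅ Ẑ(1)(k̄)` in `TopRep ℤ G_k` (`galCyclotomeIsoTateModule`,
   `GaloisCyclotomeTateModule.lean`; from the discharged `μ_{ℚ/ℤ}(G_k) ≅ μ(k̄)`, [AbsAnab] Prop. 1.2.1 (vi));
2. `H¹_cont(G_k, Ẑ(1)) ≃+ (kˣ)^∧` (`continuousCohomologyOneTateModuleEquivCompletion`,
   `TateModuleKummerCompletion.lean`: NSW II §7 Thm. 2.7.5 in degree `1` + Kummer theory
   `H¹(G_k, μ_n) = kˣ/(kˣ)ⁿ`, Serre CG II §1.2, + `(kˣ)^∧ = lim_n kˣ/(kˣ)ⁿ` since the `kˣ/(kˣ)ⁿ` are finite,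
   tree `finite_quotient_range_powMonoidHom_units`);
3. local class field theory `(kˣ)^∧ ≃ₜ* G_k^ab` — the tree's DISCHARGED form L1
   `mlf_reciprocity_completion_holds` ([AbsAnab] §1.2 p. 9, Serre LF XIII–XIV; abc-iut-L4-d1),
after realising the bare MLF `k ⊇ ℚ_p` as a non-archimedean local field (`FiniteExtension.*`).

HONEST FRAMING: [AbsTopIII] is a refereed paper; the statement proved is the tree's typing (existence of an
isomorphism of abelian groups; the composite with `G_k^ab ↠ G^unr ⥲ Ẑ` is abc-iut-L4-d3's
`exists_frobeniusQuotient_charZHat`, not repeated); nothing here bears on [IUTchIII] Cor. 3.12.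
-/

noncomputable section

open CategoryTheory Function
open Field IsNonarchimedeanLocalField ValuativeRel
open ProfiniteGrp ProfiniteGrp.ProfiniteCompletion

universe u

namespace Literature.AnabelianGeometry.AbsoluteAnabelian

open _root_.TopRep _root_.ContRepresentation _root_.ContinuousCohomology
open Literature.NumberTheory.GaloisRepresentations
open Literature.NumberTheory.GaloisRepresentations.DiscreteGaloisModule

/-- **`H¹_cont(G_K, Ẑ(1)) ≃+ G_K^ab`** for a non-archimedean local field `K` of characteristic `0`:
Kummer theory in the limit (`H¹(G_K, Ẑ(1)) ≃ (Kˣ)^∧`) followed by the reciprocity isomorphism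
`(Kˣ)^∧ ⥲ G_K^ab` of local class field theory. [cite: MochizukiAbsAnab2004, §1.2 p.9] -/
theorem nonempty_continuousCohomologyOneTateModule_equiv_abelianization (K : Type u) [Field K]
    [ValuativeRel K] [UniformSpace K] [IsUniformAddGroup K] [IsNonarchimedeanLocalField K] [CharZero K] :
    Nonempty (continuousCohomology 1 (tateModuleMu K).toTopRep ≃+
      Additive (absoluteGaloisGroupAbelianization K)) := by
  have hfin : ∀ n : ℕ+, ((powMonoidHom (n : ℕ) : Kˣ →* Kˣ).range).FiniteIndex := fun n => by
    haveI := finite_quotient_range_powMonoidHom_units K n (Nat.cast_ne_zero.2 n.ne_zero)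
    exact Subgroup.finiteIndex_of_finite_quotient
  obtain ⟨e, -⟩ := mlf_reciprocity_completion_holds K
  exact ⟨(continuousCohomologyOneTateModuleEquivCompletion K hfin).trans
    (MulEquiv.toAdditive e.toMulEquiv)⟩

/-- **[AbsTopIII] Cor. 1.10 (i)(b) — DISCHARGED**: for every MLF `k`, `H¹(G_k, μ_Ẑ(G_k)) ≃+ G_k^ab`:
abc-iut-L4-t1's named fact `AbsTopIII.Cor_1_10_i_b` is a THEOREM (`μ_{ℚ/ℤ}(G_k) ≅ μ(k̄)` equivariantly;
NSW II §7 Thm. 2.7.5 for `H¹` of the inverse limit; Kummer theory; `(kˣ)^∧ = lim_n kˣ/(kˣ)ⁿ`; the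
reciprocity isomorphism `(kˣ)^∧ ⥲ G_k^ab` — all kernel theorems of the tree).
[cite: MochizukiAbsTopIII2015, Cor 1.10 (i) p.42] -/
theorem AbsTopIII.cor_1_10_i_b_holds :
    Literature.AnabelianGeometry.AbsoluteAnabelian.AbsTopIII.Cor_1_10_i_b.{u} := by
  intro k _ _ hk
  obtain ⟨p, hp, f, hfin⟩ := hk.exists_padic
  letI : Algebra ℚ_[p] k := f.toAlgebra
  haveI : Module.Finite ℚ_[p] k := hfin
  haveI : IsNonarchimedeanLocalField ℚ_[p] := Padic.isNonarchimedeanLocalField_holds p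
  letI := FiniteExtension.normedField ℚ_[p] k
  letI := FiniteExtension.valuativeRel ℚ_[p] k
  haveI : IsNonarchimedeanLocalField k := FiniteExtension.isNonarchimedeanLocalField ℚ_[p] k
  obtain ⟨φ, hφ⟩ := mlfGaloisCyclotomeIsRootsOfUnity_holds k hk
  obtain ⟨e⟩ := nonempty_continuousCohomologyOneTateModule_equiv_abelianization k
  let i := galCyclotomeIsoTateModule k φ hφ
  exact ⟨(AddEquiv.mk' (continuousCohomologyEquivOfIso i 1)
    fun x y => map_add (cohomologyMap i.hom 1).hom x y).trans e⟩

end Literature.AnabelianGeometry.AbsoluteAnabelian
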